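import Summits.CriticalPhenomena.PercolationContinuityZ3.Theorems.PercNearOneGluingNoHeavyLowerTailSahiGridPatternStarPrefix

/-!
# `NoHeavyLowerTail` (crux stmt-CriticalPhenomena-4575), Sahi programme P1: a four-block re-indexing of the axes
# (complement, literal axes, first orthant, second orthant) — bookkeeping for the clause ∨ monomial ∨ monomial slot

Support file (Sahi cell, seat `prim-sahi-p1`, generation 22; `--supports stmt-CriticalPhenomena-4575`).  Pure proofs, no definitions,
no `sorry`, standard axioms.  `exists_block_equiv3`: for pairwise disjoint `T, S₁, S₂ ⊆ Fin d` with common complement `R`, an equivalence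
`Fin (#R + (#T + (#S₁ + #S₂))) ≃ Fin d` mapping the second block onto `T`, the third onto `S₁` and the fourth onto `S₂` (each surjectively) —
the analogue of `exists_block_equiv` (`…TwoOrthantGeneral`) with one more block.  Used in `…StarClauseTwoOrthant`. [this work]
-/

namespace Summit.CriticalPhenomena.PercolationContinuityZ3.Theorems.SahiGridPattern

open Finset

/-- **Four-block re-indexing**: complement first, then `T`, then `S₁`, then `S₂`. [this work] -/
theorem exists_block_equiv3 {d : ℕ} (T S₁ S₂ : Finset (Fin d)) (hT1 : Disjoint T S₁) (hT2 : Disjoint T S₂) (h12 : Disjoint S₁ S₂) :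
    ∃ e : Fin ((T ∪ S₁ ∪ S₂)ᶜ.card + (T.card + (S₁.card + S₂.card))) ≃ Fin d,
      (∀ i : Fin T.card, e (Fin.natAdd _ (Fin.castAdd _ i)) ∈ T) ∧
      (∀ j : Fin S₁.card, e (Fin.natAdd _ (Fin.natAdd _ (Fin.castAdd _ j))) ∈ S₁) ∧
      (∀ l : Fin S₂.card, e (Fin.natAdd _ (Fin.natAdd _ (Fin.natAdd _ l))) ∈ S₂) ∧
      (∀ s ∈ T, ∃ i : Fin T.card, e (Fin.natAdd _ (Fin.castAdd _ i)) = s) ∧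
      (∀ s ∈ S₁, ∃ j : Fin S₁.card, e (Fin.natAdd _ (Fin.natAdd _ (Fin.castAdd _ j))) = s) ∧
      (∀ s ∈ S₂, ∃ l : Fin S₂.card, e (Fin.natAdd _ (Fin.natAdd _ (Fin.natAdd _ l))) = s) := by
  classical
  set R : Finset (Fin d) := (T ∪ S₁ ∪ S₂)ᶜ with hR
  let f : (↥R ⊕ (↥T ⊕ (↥S₁ ⊕ ↥S₂))) → Fin d := fun x => match x with
    | Sum.inl r => r.1
    | Sum.inr (Sum.inl t) => t.1
    | Sum.inr (Sum.inr (Sum.inl s)) => s.1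
    | Sum.inr (Sum.inr (Sum.inr s)) => s.1
  have hRT : ∀ {a}, a ∈ R → a ∈ T → False := fun hr ht => by
    rw [hR, Finset.mem_compl] at hr; exact hr (Finset.mem_union_left _ (Finset.mem_union_left _ ht))
  have hR1 : ∀ {a}, a ∈ R → a ∈ S₁ → False := fun hr hs => by
    rw [hR, Finset.mem_compl] at hr; exact hr (Finset.mem_union_left _ (Finset.mem_union_right _ hs))
  have hR2 : ∀ {a}, a ∈ R → a ∈ S₂ → False := fun hr hs => by
    rw [hR, Finset.mem_compl] at hr; exact hr (Finset.mem_union_right _ hs)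
  have hf_inj : Function.Injective f := by
    rintro (⟨r, hr⟩ | ⟨t, ht⟩ | ⟨s, hs⟩ | ⟨s, hs⟩) (⟨r', hr'⟩ | ⟨t', ht'⟩ | ⟨s', hs'⟩ | ⟨s', hs'⟩) hxy <;> simp only [f] at hxy <;> subst hxy
    · rfl
    · exact (hRT hr ht').elim
    · exact (hR1 hr hs').elim
    · exact (hR2 hr hs').elim
    · exact (hRT hr' ht).elim
    · rfl
    · exact (Finset.disjoint_left.1 hT1 ht hs').elim
    · exact (Finset.disjoint_left.1 hT2 ht hs').elim
    · exact (hR1 hr' hs).elim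
    · exact (Finset.disjoint_left.1 hT1 ht' hs).elim
    · rfl
    · exact (Finset.disjoint_left.1 h12 hs hs').elim
    · exact (hR2 hr' hs).elim
    · exact (Finset.disjoint_left.1 hT2 ht' hs).elim
    · exact (Finset.disjoint_left.1 h12 hs' hs).elim
    · rfl
  have hf_surj : Function.Surjective f := by
    intro a
    by_cases h1 : a ∈ T
    · exact ⟨Sum.inr (Sum.inl ⟨a, h1⟩), rfl⟩
    by_cases h2 : a ∈ S₁
    · exact ⟨Sum.inr (Sum.inr (Sum.inl ⟨a, h2⟩)), rfl⟩
    by_cases h3 : a ∈ S₂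
    · exact ⟨Sum.inr (Sum.inr (Sum.inr ⟨a, h3⟩)), rfl⟩
    · refine ⟨Sum.inl ⟨a, ?_⟩, rfl⟩
      rw [hR, Finset.mem_compl, Finset.mem_union, Finset.mem_union, not_or, not_or]; exact ⟨⟨h1, h2⟩, h3⟩
  let g : (↥R ⊕ (↥T ⊕ (↥S₁ ⊕ ↥S₂))) ≃ Fin d := Equiv.ofBijective f ⟨hf_inj, hf_surj⟩
  let h0 : Fin (R.card + (T.card + (S₁.card + S₂.card))) ≃ (Fin R.card ⊕ (Fin T.card ⊕ (Fin S₁.card ⊕ Fin S₂.card))) :=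
    finSumFinEquiv.symm.trans (Equiv.sumCongr (Equiv.refl _) (finSumFinEquiv.symm.trans (Equiv.sumCongr (Equiv.refl _) finSumFinEquiv.symm)))
  let h1 : (Fin R.card ⊕ (Fin T.card ⊕ (Fin S₁.card ⊕ Fin S₂.card))) ≃ (↥R ⊕ (↥T ⊕ (↥S₁ ⊕ ↥S₂))) :=
    Equiv.sumCongr R.equivFin.symm (Equiv.sumCongr T.equivFin.symm (Equiv.sumCongr S₁.equivFin.symm S₂.equivFin.symm))
  refine ⟨(h0.trans h1).trans g, ?_, ?_, ?_, ?_, ?_, ?_⟩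
  · intro i
    have e1 : h0 (Fin.natAdd _ (Fin.castAdd _ i)) = Sum.inr (Sum.inl i) := by
      simp [h0, finSumFinEquiv_symm_apply_natAdd, finSumFinEquiv_symm_apply_castAdd]
    simp only [Equiv.trans_apply, e1]
    simp [h1, g, f, Equiv.ofBijective_apply]
  · intro j
    have e1 : h0 (Fin.natAdd _ (Fin.natAdd _ (Fin.castAdd _ j))) = Sum.inr (Sum.inr (Sum.inl j)) := by
      simp [h0, finSumFinEquiv_symm_apply_natAdd, finSumFinEquiv_symm_apply_castAdd]
    simp only [Equiv.trans_apply, e1]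
    simp [h1, g, f, Equiv.ofBijective_apply]
  · intro l
    have e1 : h0 (Fin.natAdd _ (Fin.natAdd _ (Fin.natAdd _ l))) = Sum.inr (Sum.inr (Sum.inr l)) := by
      simp [h0, finSumFinEquiv_symm_apply_natAdd]
    simp only [Equiv.trans_apply, e1]
    simp [h1, g, f, Equiv.ofBijective_apply]
  · intro s hs
    refine ⟨T.equivFin ⟨s, hs⟩, ?_⟩
    have e1 : h0 (Fin.natAdd _ (Fin.castAdd _ (T.equivFin ⟨s, hs⟩))) = Sum.inr (Sum.inl (T.equivFin ⟨s, hs⟩)) := by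
      simp [h0, finSumFinEquiv_symm_apply_natAdd, finSumFinEquiv_symm_apply_castAdd]
    simp only [Equiv.trans_apply, e1]
    simp [h1, g, f, Equiv.ofBijective_apply]
  · intro s hs
    refine ⟨S₁.equivFin ⟨s, hs⟩, ?_⟩
    have e1 : h0 (Fin.natAdd _ (Fin.natAdd _ (Fin.castAdd _ (S₁.equivFin ⟨s, hs⟩)))) = Sum.inr (Sum.inr (Sum.inl (S₁.equivFin ⟨s, hs⟩))) := by
      simp [h0, finSumFinEquiv_symm_apply_natAdd, finSumFinEquiv_symm_apply_castAdd]
    simp only [Equiv.trans_apply, e1]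
    simp [h1, g, f, Equiv.ofBijective_apply]
  · intro s hs
    refine ⟨S₂.equivFin ⟨s, hs⟩, ?_⟩
    have e1 : h0 (Fin.natAdd _ (Fin.natAdd _ (Fin.natAdd _ (S₂.equivFin ⟨s, hs⟩)))) = Sum.inr (Sum.inr (Sum.inr (S₂.equivFin ⟨s, hs⟩))) := by
      simp [h0, finSumFinEquiv_symm_apply_natAdd]
    simp only [Equiv.trans_apply, e1]
    simp [h1, g, f, Equiv.ofBijective_apply]

end Summit.CriticalPhenomena.PercolationContinuityZ3.Theorems.SahiGridPattern
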